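import Summits.QuantumFields.BalabanUV.Beta.FP.PerfectPropagatorSymbol
import Summits.QuantumFields.BalabanUV.Beta.FP.PerfectSymbolPerm

/-!
# `BalabanUV.Beta.FP.PerfectPropagatorSymbolPerm` — road «FP» for binder row D1, row PERM-COV in momentum space, part 2: the weighted Maxwell MATRIX symbol,
# its Feynman completion and the UNCONSTRAINED PERFECT PROPAGATOR SYMBOL `PinfSym` (owner's H2-P-MAT `FP/PerfectPropagatorSymbol`) are permutation-covariant,
# `PinfSym (σ•s) (σ•ph) = (PinfSym s ph).submatrix σ⁻¹ σ⁻¹`, and PHASE-covariant, `PinfSym s (c·ph) = diag c · PinfSym s ph · diag c̄` (`|c| = 1`, the image of bond re-basing)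

HONEST DEPENDENCY (page 1, mandatory): continuum YM on T⁴ ⇐ BetaPertH ∧ nine spine estimates (0/9 proved); BetaPertH ⇐ (D1) ∧ (D4) ∧ CAP+tail;
G-an2-4 gates asym, D1 and NE2/3/4.  HONEST FRAMING (cell contract, verbatim): «discharging `BetaPertH` makes Bałaban's UV stability UNCONDITIONAL —
a real constructive-QFT result; it is NOT the continuum limit and NOT the Clay problem.»  THIS MODULE DISCHARGES NOTHING of the wall: [folklore] re-indexing of
finite sums over `Fin d` by a permutation and Mathlib's `Matrix.submatrix` ∕ inverse calculus, applied to the owner's data defs `curlRow` ∕ `maxwellMat` ∕ `feynMat` ∕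
`PinfSym` (p231001) with `KernelPermutation.psite σ : x ↦ x ∘ σ⁻¹` and part 1's `PerfectSymbolPerm.W166Inf_psite`.  No `def`, no `def … : Prop`, nothing cited,
0 sorry; 0 wall binders; NOT D1, NOT BetaPertH, NOT continuum, NOT Clay.
CONTENT ([folklore]): `curlRow_psite`; **`maxwellMat_psite : maxwellMat W (σ•ph) = (maxwellMat (W ∘ (σ×σ)) ph).submatrix σ⁻¹ σ⁻¹`**; `feynMat_psite`;
`maxwellMat_W166Inf_psite` ∕ `feynMat_W166Inf_psite` (at the weights `Re W_∞(·,·;σ•s)` the family `W ∘ (σ×σ)` IS `Re W_∞(·,·;s)`); **`PinfSym_psite`** — the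
unconstrained perfect propagator symbol at the permuted momentum is the conjugate of the one at `s` by the permutation matrix (`Matrix.inv_submatrix_equiv`).
§2 PHASES (the momentum image of bond re-basing under an axis REFLECTION): for unit-modulus `c : Fin d → ℂ`, `maxwellQ_phase` (`maxwellQ W (c·ph) (c·v) = maxwellQ W ph v`),
`curlRow_phase`, `maxwellMat_phase(_eq)` ∕ `feynMat_phase_eq` (`= diag c · M · diag c̄`), **`PinfSym_phase : PinfSym s (c·ph) = diag c · PinfSym s ph · diag c̄`**, and the reading
`rebasing_phase : e^{−is} − 1 = (−e^{−is})·(e^{is} − 1)`, `norm_rebasing_phase` — with part 1's `W166Inf_cflip` this is the REFLECTION letter in momentum space.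
USE: the hyperoctahedral letters (permutations §1 + reflections §2 ∕ part 1 §4) for road FP's H2-P propagator and everything H2-V ∕ H2-G dress with it.
Unit `b2b-balaban-beta-d1-formalise-leaf-01` (gen 7), 2026-08-20; claim table `HOME/b2b-balaban-beta-d1-p3/LEAVES-FP.md` sub-row PERM-COV-SYMBOL.
ABSOLUTE RULE (cell charter, verbatim): «No internally-minted statement may enter as a cited fact. Every hypothesis is either kernel-proved in this package or a
verbatim quotation of a PUBLISHED theorem with page reference. The manuscript(s) under audit are NOT citable for their own disputed steps — they are the thing
under adjudication; programme-internal (2001/route/tribunal) claims are never citable.»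
-/

noncomputable section

namespace Summit.QuantumFields.BalabanUV.Beta.FP.PerfectPropagatorSymbolPerm

open Finset Matrix
open scoped BigOperators ComplexConjugate
open Literature.MathematicalPhysics.QuantumFieldTheory.Balaban1983to89
open B4Strip (ofRealVec)
open B4ContourShift (BZ)
open Summit.QuantumFields.BalabanUV.Beta.KernelPermutation (psite psite_apply)
open Summit.QuantumFields.BalabanUV.Beta.FP.PerfectSymbol166 (W166Inf)
open Summit.QuantumFields.BalabanUV.Beta.FP.PerfectSymbolPerm (W166Inf_psite ofRealVec_psite)
open Summit.QuantumFields.BalabanUV.Beta.FP.PerfectPropagatorSymbol (curlRow maxwellMat feynMat PinfSym)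

variable {d : ℕ} (σ : Equiv.Perm (Fin d))

/-- [folklore] The curl row of the permuted momentum factors is the re-indexed curl row of the re-indexed orientation. -/
theorem curlRow_psite (ph : Fin d → ℂ) (μ ν α : Fin d) :
    curlRow (psite σ ph) μ ν α = curlRow ph (σ.symm μ) (σ.symm ν) (σ.symm α) := by
  unfold curlRow
  simp only [psite_apply, EmbeddingLike.apply_eq_iff_eq]

/-- [folklore] **PERMUTATION COVARIANCE OF THE WEIGHTED MAXWELL MATRIX SYMBOL**: `maxwellMat W (σ•ph) = (maxwellMat (fun μ ν => W (σ μ) (σ ν)) ph).submatrix σ⁻¹ σ⁻¹`. -/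
theorem maxwellMat_psite (W : Fin d → Fin d → ℝ) (ph : Fin d → ℂ) :
    maxwellMat W (psite σ ph) = (maxwellMat (fun μ ν => W (σ μ) (σ ν)) ph).submatrix σ.symm σ.symm := by
  ext α β
  rw [submatrix_apply]
  unfold maxwellMat
  rw [← Equiv.sum_comp σ]
  refine sum_congr rfl fun μ _ => ?_
  rw [← Equiv.sum_comp σ]
  refine sum_congr rfl fun ν _ => ?_
  simp only [curlRow_psite, Equiv.symm_apply_apply, EmbeddingLike.apply_eq_iff_eq]

/-- [folklore] … and of its Feynman completion (the slice projector `ph⊗ph†` re-indexes entrywise). -/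
theorem feynMat_psite (W : Fin d → Fin d → ℝ) (ph : Fin d → ℂ) :
    feynMat W (psite σ ph) = (feynMat (fun μ ν => W (σ μ) (σ ν)) ph).submatrix σ.symm σ.symm := by
  ext α β
  show maxwellMat W (psite σ ph) α β + psite σ ph α * conj (psite σ ph β) =
    maxwellMat (fun μ ν => W (σ μ) (σ ν)) ph (σ.symm α) (σ.symm β) + ph (σ.symm α) * conj (ph (σ.symm β))
  rw [maxwellMat_psite, submatrix_apply, psite_apply, psite_apply]

/-- [folklore] At the perfect weights: the re-indexed family `Re W_∞(σ·,σ·;σ•s)` IS `Re W_∞(·,·;s)` (`PerfectSymbolPerm.W166Inf_psite`). -/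
theorem W166_weights_psite (s : Fin d → ℝ) :
    (fun μ ν => (W166Inf (σ μ) (σ ν) (ofRealVec (psite σ s))).re) = fun μ ν => (W166Inf μ ν (ofRealVec s)).re := by
  funext μ ν
  rw [← ofRealVec_psite, W166Inf_psite]

/-- [our object] **THE PERFECT WEIGHTED MAXWELL MATRIX SYMBOL AT A PERMUTED MOMENTUM** is the permutation-conjugate of the one at `s`. -/
theorem maxwellMat_W166Inf_psite (s : Fin d → ℝ) (ph : Fin d → ℂ) :
    maxwellMat (fun μ ν => (W166Inf μ ν (ofRealVec (psite σ s))).re) (psite σ ph)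
      = (maxwellMat (fun μ ν => (W166Inf μ ν (ofRealVec s)).re) ph).submatrix σ.symm σ.symm := by
  rw [maxwellMat_psite, W166_weights_psite]

/-- [our object] … and the Feynman-completed perfect symbol. -/
theorem feynMat_W166Inf_psite (s : Fin d → ℝ) (ph : Fin d → ℂ) :
    feynMat (fun μ ν => (W166Inf μ ν (ofRealVec (psite σ s))).re) (psite σ ph)
      = (feynMat (fun μ ν => (W166Inf μ ν (ofRealVec s)).re) ph).submatrix σ.symm σ.symm := by
  rw [feynMat_psite, W166_weights_psite]

/-- [our object] **PERMUTATION COVARIANCE OF THE UNCONSTRAINED PERFECT PROPAGATOR SYMBOL**: `PinfSym (σ•s) (σ•ph) = (PinfSym s ph).submatrix σ⁻¹ σ⁻¹`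
(inverse of a permutation-conjugate = permutation-conjugate of the inverse, `Matrix.inv_submatrix_equiv`; no invertibility hypothesis is needed for the
identity of the `nonsing_inv`s). -/
theorem PinfSym_psite (s : Fin d → ℝ) (ph : Fin d → ℂ) :
    PinfSym (psite σ s) (psite σ ph) = (PinfSym s ph).submatrix σ.symm σ.symm := by
  unfold PinfSym
  rw [feynMat_W166Inf_psite, Matrix.inv_submatrix_equiv]

/-- [our object] Entrywise reading: `PinfSym (σ•s) (σ•ph) (σ α) (σ β) = PinfSym s ph α β`. -/
theorem PinfSym_psite_apply (s : Fin d → ℝ) (ph : Fin d → ℂ) (α β : Fin d) :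
    PinfSym (psite σ s) (psite σ ph) (σ α) (σ β) = PinfSym s ph α β := by
  rw [PinfSym_psite, submatrix_apply, Equiv.symm_apply_apply, Equiv.symm_apply_apply]

/-! ## §2 Unit-modulus phases (the momentum-space image of bond re-basing under an axis reflection): phase covariance -/

section Phase

variable {c : Fin d → ℂ}

/-- [folklore] `conj (c a) * c a = 1` for a unit-modulus phase. -/
theorem conj_mul_self_of_norm (hc : ∀ a, ‖c a‖ = 1) (a : Fin d) : conj (c a) * c a = 1 := by
  rw [mul_comm, Complex.mul_conj, Complex.normSq_eq_norm_sq, hc a]; norm_num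

/-- [folklore] `c a * conj (c a) = 1` for a unit-modulus phase. -/
theorem self_mul_conj_of_norm (hc : ∀ a, ‖c a‖ = 1) (a : Fin d) : c a * conj (c a) = 1 := by
  rw [mul_comm]; exact conj_mul_self_of_norm hc a

/-- [folklore] **THE WEIGHTED MAXWELL FORM IS PHASE-INVARIANT**: for unit-modulus `c`, `maxwellQ W (c·ph) (c·v) = maxwellQ W ph v` (every plaquette term picks up
`|c_μ c_ν|² = 1`). -/
theorem maxwellQ_phase (hc : ∀ a, ‖c a‖ = 1) (W : Fin d → Fin d → ℝ) (ph v : Fin d → ℂ) :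
    PerfectMaxwellSymbol.maxwellQ W (c * ph) (c * v) = PerfectMaxwellSymbol.maxwellQ W ph v := by
  unfold PerfectMaxwellSymbol.maxwellQ
  refine sum_congr rfl fun μ _ => sum_congr rfl fun ν _ => ?_
  split_ifs with h
  · rfl
  · have e : (c * ph) μ * (c * v) ν - (c * ph) ν * (c * v) μ = (c μ * c ν) * (ph μ * v ν - ph ν * v μ) := by
      simp only [Pi.mul_apply]; ring
    rw [e, norm_mul, norm_mul, hc μ, hc ν, one_mul, one_mul]

/-- [folklore] The curl row of phased momentum factors: `curlRow (c·ph) μ ν α = c μ · c ν · conj(c α) · curlRow ph μ ν α` (unit-modulus `c`). -/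
theorem curlRow_phase (hc : ∀ a, ‖c a‖ = 1) (ph : Fin d → ℂ) (μ ν α : Fin d) :
    curlRow (c * ph) μ ν α = c μ * c ν * conj (c α) * curlRow ph μ ν α := by
  unfold curlRow
  simp only [Pi.mul_apply]
  by_cases hν : α = ν
  · subst hν
    by_cases hμ : α = μ
    · subst hμ; simp
    · rw [if_pos rfl, if_neg hμ, if_pos rfl, if_neg hμ, sub_zero, sub_zero]
      calc c μ * ph μ = c μ * (c α * conj (c α)) * ph μ := by rw [self_mul_conj_of_norm hc, mul_one]
        _ = c μ * c α * conj (c α) * ph μ := by ring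
  · by_cases hμ : α = μ
    · subst hμ
      rw [if_neg hν, if_pos rfl, if_neg hν, if_pos rfl, zero_sub, zero_sub]
      calc -(c ν * ph ν) = -(c ν * (c α * conj (c α)) * ph ν) := by rw [self_mul_conj_of_norm hc, mul_one]
        _ = c α * c ν * conj (c α) * -ph ν := by ring
    · rw [if_neg hν, if_neg hμ, if_neg hν, if_neg hμ, sub_zero, mul_zero]

/-- [folklore] **THE WEIGHTED MAXWELL MATRIX IS PHASE-COVARIANT**: `maxwellMat W (c·ph) α β = c α · conj(c β) · maxwellMat W ph α β` (unit-modulus `c`), i.e.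
`M(c·ph) = D M(ph) D†`, `D = diag c`. -/
theorem maxwellMat_phase (hc : ∀ a, ‖c a‖ = 1) (W : Fin d → Fin d → ℝ) (ph : Fin d → ℂ) (α β : Fin d) :
    maxwellMat W (c * ph) α β = c α * conj (c β) * maxwellMat W ph α β := by
  unfold maxwellMat
  rw [Finset.mul_sum]
  refine sum_congr rfl fun μ _ => ?_
  rw [Finset.mul_sum]
  refine sum_congr rfl fun ν _ => ?_
  split_ifs with h
  · rw [mul_zero]
  · rw [curlRow_phase hc, curlRow_phase hc]
    simp only [map_mul, Complex.conj_conj]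
    have hμ := conj_mul_self_of_norm hc μ
    have hν := conj_mul_self_of_norm hc ν
    calc ((((1 / 2 : ℝ) * W μ ν : ℝ)) : ℂ) * (conj (c μ) * conj (c ν) * c α * conj (curlRow ph μ ν α) * (c μ * c ν * conj (c β) * curlRow ph μ ν β))
        = (conj (c μ) * c μ) * (conj (c ν) * c ν) *
            (c α * conj (c β) * ((((1 / 2 : ℝ) * W μ ν : ℝ) : ℂ) * (conj (curlRow ph μ ν α) * curlRow ph μ ν β))) := by ring
      _ = c α * conj (c β) * ((((1 / 2 : ℝ) * W μ ν : ℝ) : ℂ) * (conj (curlRow ph μ ν α) * curlRow ph μ ν β)) := by rw [hμ, hν, one_mul, one_mul]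

/-- [folklore] In matrix form: `maxwellMat W (c·ph) = diag c * maxwellMat W ph * diag (conj c)`. -/
theorem maxwellMat_phase_eq (hc : ∀ a, ‖c a‖ = 1) (W : Fin d → Fin d → ℝ) (ph : Fin d → ℂ) :
    maxwellMat W (c * ph) = Matrix.diagonal c * maxwellMat W ph * Matrix.diagonal (star c) := by
  ext α β
  rw [Matrix.mul_diagonal, Matrix.diagonal_mul, maxwellMat_phase hc]
  simp only [Pi.star_apply, RCLike.star_def]
  ring

/-- [folklore] … and the Feynman completion: `feynMat W (c·ph) = diag c * feynMat W ph * diag (conj c)`. -/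
theorem feynMat_phase_eq (hc : ∀ a, ‖c a‖ = 1) (W : Fin d → Fin d → ℝ) (ph : Fin d → ℂ) :
    feynMat W (c * ph) = Matrix.diagonal c * feynMat W ph * Matrix.diagonal (star c) := by
  ext α β
  rw [Matrix.mul_diagonal, Matrix.diagonal_mul]
  show maxwellMat W (c * ph) α β + (c * ph) α * conj ((c * ph) β) = c α * (maxwellMat W ph α β + ph α * conj (ph β)) * star c β
  rw [maxwellMat_phase hc]
  simp only [Pi.mul_apply, map_mul, Pi.star_apply, RCLike.star_def]
  ring

/-- [folklore] The diagonal phase matrix is unitary: `diag c * diag (conj c) = 1`. -/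
theorem diagonal_mul_diagonal_star (hc : ∀ a, ‖c a‖ = 1) : Matrix.diagonal c * Matrix.diagonal (star c) = (1 : Matrix (Fin d) (Fin d) ℂ) := by
  rw [Matrix.diagonal_mul_diagonal, ← Matrix.diagonal_one]
  congr 1
  funext a
  simp only [Pi.star_apply, RCLike.star_def]
  exact self_mul_conj_of_norm hc a

/-- [folklore] … and `diag (conj c) * diag c = 1`. -/
theorem diagonal_star_mul_diagonal (hc : ∀ a, ‖c a‖ = 1) : Matrix.diagonal (star c) * Matrix.diagonal c = (1 : Matrix (Fin d) (Fin d) ℂ) := by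
  rw [Matrix.diagonal_mul_diagonal, ← Matrix.diagonal_one]
  congr 1
  funext a
  simp only [Pi.star_apply, RCLike.star_def]
  exact conj_mul_self_of_norm hc a

/-- [our object] **PHASE COVARIANCE OF THE UNCONSTRAINED PERFECT PROPAGATOR SYMBOL**: `PinfSym s (c·ph) = diag c * PinfSym s ph * diag (conj c)` for unit-modulus
`c` (the inverse of a unitary conjugate is the unitary conjugate of the inverse; unconditional for `Matrix.inv`). -/
theorem PinfSym_phase (hc : ∀ a, ‖c a‖ = 1) (s : Fin d → ℝ) (ph : Fin d → ℂ) :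
    PinfSym s (c * ph) = Matrix.diagonal c * PinfSym s ph * Matrix.diagonal (star c) := by
  unfold PinfSym
  rw [feynMat_phase_eq hc, Matrix.mul_inv_rev, Matrix.mul_inv_rev,
    Matrix.inv_eq_left_inv (diagonal_mul_diagonal_star hc), Matrix.inv_eq_left_inv (diagonal_star_mul_diagonal hc), Matrix.mul_assoc]

/-- [folklore] **THE READING** (asserted nowhere else): under the reflection of the axis `α`, the momentum factor of an `α`-bond `e^{is} − 1` at the flipped
momentum `−s` is the unit-modulus phase `−e^{−is}` times the original — `e^{−is} − 1 = (−e^{−is})·(e^{is} − 1)`; so an axis reflection acts on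
`(s, ph, v)` by `PerfectSymbolPerm.cflip α` on `s` and by a unit-modulus phase on the `α`-components, and §2 + `PerfectSymbolPerm.W166Inf_cflip` give the
reflection letter of `maxwellQ (Re W_∞)`, `maxwellMat`, `PinfSym`. -/
theorem rebasing_phase (s : ℝ) :
    Complex.exp (-(Complex.I * s)) - 1 = -Complex.exp (-(Complex.I * s)) * (Complex.exp (Complex.I * s) - 1) := by
  have h : Complex.exp (-(Complex.I * s)) * Complex.exp (Complex.I * s) = 1 := by
    rw [← Complex.exp_add, neg_add_cancel, Complex.exp_zero]
  calc Complex.exp (-(Complex.I * s)) - 1 = Complex.exp (-(Complex.I * s)) - Complex.exp (-(Complex.I * s)) * Complex.exp (Complex.I * s) := by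
        rw [h]
    _ = -Complex.exp (-(Complex.I * s)) * (Complex.exp (Complex.I * s) - 1) := by ring

/-- [folklore] … and that phase has unit modulus. -/
theorem norm_rebasing_phase (s : ℝ) : ‖-Complex.exp (-(Complex.I * s))‖ = 1 := by
  rw [norm_neg, Complex.norm_exp]
  simp

end Phase

end Summit.QuantumFields.BalabanUV.Beta.FP.PerfectPropagatorSymbolPerm

end
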